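import Summits.QuantumFields.YangMills.Theorems.BalabanUVNodesN15KingModelBoxSumRulesResolvent
import Summits.QuantumFields.YangMills.Theorems.BalabanUVNodesN15KingModelBoxGreenDiagonal
import Literature.MathematicalPhysics.QuantumFieldTheory.King1986.CovarianceSplittingUnits
import HarnessLib

/-!
# BalabanUVNodes ∕ N15 — THE KING-MODEL RUNG (PART Ϟ-w): CHANGE OF UNITS `(c, m²) ↦ (sc, sm²)` — the free operators are HOMOGENEOUS: `lapSym` and the operators scale by `s`, the
# covariances by `s⁻¹` (torus, box, infinite volume), the free energy densities shift by `ln s` (torus, box, `f_∞`); in particular everything reduces to UNIT MASS: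
# `f(c, m²) = ln m² + f(c∕m², 1)`, `G_{c,m²} = m⁻²G_{c∕m²,1}` (Track A, DAG node N15 = NE2; FAN-OUT v1.1 §N15 s3 «KING-MODEL RUNG»; King (2.20) p.654, (3.89) p.668, (4.4) p.670; count-neutral)

HONEST FRAMING.  Count-neutral (cell `pub-ymgap`, seat `pub-ymgap-dag-n15-e` g41; K3ᴬ key **stmt-QuantumFields-27247** `--supports … --as helper` per KEY MAP v3).  TEMPLATE LITERATURE:
C. King, Commun. Math. Phys. **102** (1986) 649–677 [King1986]: (2.13)∕(2.17) p.653, (2.20) p.654 (change of units between RG levels), (3.89) p.668, (4.4) p.670, §4 p.670 l.8–13;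
T. Bałaban, Commun. Math. Phys. **89** (1983) 571–597 [Balaban1983RegularityDecay]: (2.43) p.584.  The Literature port `King1986.CovarianceSplittingUnits.lapF_scale` (`lapF (sc) (sm²) =
s·lapF c m²`) is the seed; THIS FILE draws the consequences for every object of the rung: §1 TORUS `lapSym_scale_units`, ★ `log_det_lapF_scale` (`ln det = |T|ln s + ln det`), ★★
**`log_det_lapF_div_card_scale`** (`f_T(sc,sm²) = ln s + f_T(c,m²)`), ★★ **`lapF_inv_scale`** (`G_{sc,sm²} = s⁻¹G_{c,m²}`), ★ `log_det_lapF_div_card_eq_log_mass_add` (unit-mass reduction);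
§2 BOX `boxOp_scale`, ★ `log_det_boxOp_scale`, ★★ **`log_det_boxOp_div_card_scale`**, ★★ **`kingBoxGreen_scale`**; §3 INFINITE VOLUME `freeSymC_scale`, ★★ **`freeKer_scale`** (`K_∞` scales by
`s⁻¹`, `latticeKernel_const_mul`), ★★ **`kingFreeEnergyInf_scale`** (`f_∞(sc,sm²) = ln s + f_∞(c,m²)`, by uniqueness of the thermodynamic limit along cubes), ★ `kingFreeEnergyInf_eq_log_mass_add`.

PRIOR TREE ART (named, USED not restated): `King1986.Torus.lapF_scale`, Ε-k (`log_det_lapF`, `det_lapF_pos`), Ϟ-c (`log_det_boxOp`, `det_boxOp_pos`), Ν (`kingBoxGreen`, image sum over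
`lapF (dblPer n)`), Ε-a (`freeSymC`, `freeMultC`, `freeKerC`, `freeKer`), Ε-m (`kingFreeEnergyInf`, `tendsto_log_det_lapF_div_card`), `B4Green242Bridge` (`latticeKernel_const_mul`), Mathlib
(`Matrix.det_smul`, `Matrix.inv_eq_right_inv`, `tendsto_nhds_unique`).  NOT Bałaban's covariant objects; NOT a node discharge (N15 is booked through n15-a's knit, untouched); nothing
continuum-YM ∕ `ℝ⁴` ∕ OS ∕ Clay.  0 `sorry`; 0 `def`.

HONEST SCOPE.  King's `A = 0` free symbol ∕ operators; scale `s > 0` (for the operator identities `s ≠ 0` or any `s`), `c ≥ 0`, `m² > 0` where logarithms ∕ inverses occur.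
Locators: [King1986] (2.13)∕(2.17) p.653, (2.20) p.654, (3.89) p.668, (4.4) p.670, §4 p.670 l.8–13; [Balaban1983RegularityDecay] (2.43) p.584.
-/

noncomputable section

open scoped BigOperators Topology
open Finset Filter Matrix

namespace Summit.QuantumFields.YangMills.BalabanUVNodes.N15KingModelRung.TorusSpectral

open Literature.MathematicalPhysics.QuantumFieldTheory.Balaban1983to89.B5Prop11Plancherel (Tor sOf)
open Literature.MathematicalPhysics.QuantumFieldTheory.Balaban1983to89.B4Strip (S1)
open Literature.MathematicalPhysics.QuantumFieldTheory.Balaban1983to89.B4ContourShift (latticeKernel)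
open Literature.MathematicalPhysics.QuantumFieldTheory.Balaban1983to89.B4Green242Bridge (latticeKernel_const_mul)
open Literature.MathematicalPhysics.QuantumFieldTheory.King1986.Torus

variable {d : ℕ}

/-! ## §1 The torus -/

section Torus

variable (K : Fin (d + 1) → ℕ) [hK : ∀ i, NeZero (K i)]

omit hK in
/-- `lapSym K (sc) (sm²) q = s·lapSym K c m² q`. [cite: King1986, (2.20) p.654, (4.4) p.670] -/
theorem lapSym_scale_units (s c m2 : ℝ) (q : Tor K) : lapSym K (s * c) (s * m2) q = s * lapSym K c m2 q := by
  unfold lapSym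
  ring

/-- ★ `ln det(lapF K (sc) (sm²)) = |T|·ln s + ln det(lapF K c m²)` (`s > 0`, `c ≥ 0`, `m² > 0`). [cite: King1986, (2.20) p.654, (3.89) p.668] -/
theorem log_det_lapF_scale {s c m2 : ℝ} (hs : 0 < s) (hc : 0 ≤ c) (hm : 0 < m2) :
    Real.log (lapF K (s * c) (s * m2)).det = Fintype.card (Tor K) * Real.log s + Real.log (lapF K c m2).det := by
  rw [lapF_scale K s c m2, Matrix.det_smul, Real.log_mul (pow_ne_zero _ hs.ne') (det_lapF_pos K hc hm).ne', Real.log_pow]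

/-- ★★ **THE PERIODIC FREE ENERGY DENSITY UNDER A CHANGE OF UNITS**: `f_T(sc, sm²) = ln s + f_T(c, m²)`. [cite: King1986, (2.20) p.654, (3.89) p.668] -/
theorem log_det_lapF_div_card_scale {s c m2 : ℝ} (hs : 0 < s) (hc : 0 ≤ c) (hm : 0 < m2) :
    (Fintype.card (Tor K) : ℝ)⁻¹ * Real.log (lapF K (s * c) (s * m2)).det = Real.log s + (Fintype.card (Tor K) : ℝ)⁻¹ * Real.log (lapF K c m2).det := by
  have hcard : (Fintype.card (Tor K) : ℝ) ≠ 0 := by exact_mod_cast Fintype.card_ne_zero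
  rw [log_det_lapF_scale K hs hc hm, mul_add, ← mul_assoc, inv_mul_cancel₀ hcard, one_mul]

/-- ★★ **THE TORUS COVARIANCE UNDER A CHANGE OF UNITS**: `(lapF K (sc) (sm²))⁻¹ = s⁻¹·(lapF K c m²)⁻¹` (`s ≠ 0`, `c ≥ 0`, `m² > 0`). [cite: King1986, (2.17) p.653, (2.20) p.654] -/
theorem lapF_inv_scale {s c m2 : ℝ} (hs : s ≠ 0) (hc : 0 ≤ c) (hm : 0 < m2) : (lapF K (s * c) (s * m2))⁻¹ = s⁻¹ • (lapF K c m2)⁻¹ := by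
  have hdet : IsUnit (lapF K c m2).det := isUnit_iff_ne_zero.mpr (det_lapF_pos K hc hm).ne'
  rw [lapF_scale K s c m2]
  refine Matrix.inv_eq_right_inv ?_
  rw [Matrix.smul_mul, Matrix.mul_smul, Matrix.mul_nonsing_inv _ hdet, smul_smul, mul_inv_cancel₀ hs, one_smul]

/-- entrywise: `G_{sc,sm²}(x,y) = s⁻¹G_{c,m²}(x,y)`. [cite: King1986, (2.17) p.653, (2.20) p.654] -/
theorem lapF_inv_scale_apply {s c m2 : ℝ} (hs : s ≠ 0) (hc : 0 ≤ c) (hm : 0 < m2) (x y : Tor K) :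
    (lapF K (s * c) (s * m2))⁻¹ x y = s⁻¹ * (lapF K c m2)⁻¹ x y := by
  rw [lapF_inv_scale K hs hc hm, Matrix.smul_apply, smul_eq_mul]

/-- ★ **REDUCTION TO UNIT MASS**: `f_T(c, m²) = ln m² + f_T(c∕m², 1)` and `G_{c,m²} = m⁻²·G_{c∕m²,1}`. [cite: King1986, (2.20) p.654, (3.89) p.668] -/
theorem log_det_lapF_div_card_eq_log_mass_add {c m2 : ℝ} (hc : 0 ≤ c) (hm : 0 < m2) :
    (Fintype.card (Tor K) : ℝ)⁻¹ * Real.log (lapF K c m2).det = Real.log m2 + (Fintype.card (Tor K) : ℝ)⁻¹ * Real.log (lapF K (c / m2) 1).det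
    ∧ (lapF K c m2)⁻¹ = m2⁻¹ • (lapF K (c / m2) 1)⁻¹ := by
  have e1 : m2 * (c / m2) = c := mul_div_cancel₀ c hm.ne'
  have e2 : m2 * (1 : ℝ) = m2 := mul_one m2
  have h1 := log_det_lapF_div_card_scale K hm (div_nonneg hc hm.le) one_pos
  have h2 := lapF_inv_scale K hm.ne' (div_nonneg hc hm.le) one_pos
  rw [e1, e2] at h1 h2
  exact ⟨h1, h2⟩

end Torus

/-! ## §2 The box with free boundary conditions -/

section Box

variable (n : Fin (d + 1) → ℕ) [hn : ∀ μ, NeZero (n μ)]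

omit hn in
/-- `(c(−Δ_free)+m²)_Ω` is homogeneous: `boxOp n (sc) (sm²) = s·boxOp n c m²`. [cite: King1986, (2.13) p.653, (2.20) p.654, §4 p.670 l.8–13] -/
theorem boxOp_scale (s c m2 : ℝ) : boxOp n (s * c) (s * m2) = s • boxOp n c m2 := by
  ext x y
  simp only [boxOp, Matrix.smul_apply, smul_eq_mul]
  ring

/-- ★ `ln det(c(−Δ_free)+m²)_Ω` under a change of units: `= |Ω|·ln s + …`. [cite: King1986, (2.20) p.654, (3.89) p.668] -/
theorem log_det_boxOp_scale {s c m2 : ℝ} (hs : 0 < s) (hc : 0 ≤ c) (hm : 0 < m2) :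
    Real.log (boxOp n (s * c) (s * m2)).det = Fintype.card (KingBox n) * Real.log s + Real.log (boxOp n c m2).det := by
  rw [boxOp_scale n s c m2, Matrix.det_smul, Real.log_mul (pow_ne_zero _ hs.ne') (det_boxOp_pos n hc hm).ne', Real.log_pow]

/-- ★★ **THE FREE-BOUNDARY FREE ENERGY DENSITY UNDER A CHANGE OF UNITS**: `f_Ω(sc, sm²) = ln s + f_Ω(c, m²)`. [cite: King1986, (2.20) p.654, (3.89) p.668, §4 p.670 l.8–13] -/
theorem log_det_boxOp_div_card_scale {s c m2 : ℝ} (hs : 0 < s) (hc : 0 ≤ c) (hm : 0 < m2) :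
    (Fintype.card (KingBox n) : ℝ)⁻¹ * Real.log (boxOp n (s * c) (s * m2)).det = Real.log s + (Fintype.card (KingBox n) : ℝ)⁻¹ * Real.log (boxOp n c m2).det := by
  have hcard : (Fintype.card (KingBox n) : ℝ) ≠ 0 := by exact_mod_cast Fintype.card_ne_zero
  rw [log_det_boxOp_scale n hs hc hm, mul_add, ← mul_assoc, inv_mul_cancel₀ hcard, one_mul]

/-- ★★ **THE NEUMANN GREEN's FUNCTION UNDER A CHANGE OF UNITS**: `G^Ω_{sc,sm²}(s′,t) = s⁻¹·G^Ω_{c,m²}(s′,t)` (image by image). [cite: King1986, (2.17) p.653, (2.20) p.654, §4 p.670 l.8–13] -/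
theorem kingBoxGreen_scale {s c m2 : ℝ} (hs : s ≠ 0) (hc : 0 ≤ c) (hm : 0 < m2) (x y : KingBox n) :
    kingBoxGreen n (s * c) (s * m2) x y = s⁻¹ * kingBoxGreen n c m2 x y := by
  unfold kingBoxGreen
  rw [Finset.mul_sum]
  exact Finset.sum_congr rfl fun S _ => lapF_inv_scale_apply (dblPer n) hs hc hm _ _

end Box

/-! ## §3 Infinite volume -/

section Infinite

/-- the complex symbol is homogeneous: `freeSymC (sc) (sm²) p = s·freeSymC c m² p`. [cite: King1986, (4.4) p.670] -/
theorem freeSymC_scale (s c m2 : ℝ) (p : Fin (d + 1) → ℂ) : freeSymC (s * c) (s * m2) p = (s : ℂ) * freeSymC c m2 p := by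
  unfold freeSymC
  push_cast
  ring

/-- the multiplier scales by `s⁻¹`. [cite: King1986, (4.4) p.670] -/
theorem freeMultC_scale (s c m2 : ℝ) (p : Fin (d + 1) → ℂ) : freeMultC (s * c) (s * m2) p = (s : ℂ)⁻¹ * freeMultC c m2 p := by
  unfold freeMultC
  rw [freeSymC_scale, mul_inv]

/-- ★★ **`K_∞` UNDER A CHANGE OF UNITS**: `freeKer (sc) (sm²) z = s⁻¹·freeKer c m² z` (every real `s`, `z ∈ ℤ^{d+1}`). [cite: Balaban1983RegularityDecay, (2.43) p.584; King1986, (2.20) p.654] -/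
theorem freeKer_scale (s c m2 : ℝ) (z : Fin (d + 1) → ℤ) : freeKer (s * c) (s * m2) z = s⁻¹ * freeKer c m2 z := by
  have h : freeKerC (s * c) (s * m2) z = (s : ℂ)⁻¹ * freeKerC c m2 z := by
    unfold freeKerC
    rw [← latticeKernel_const_mul]
    congr 1
    funext p
    exact freeMultC_scale s c m2 p
  unfold freeKer
  rw [h, ← Complex.ofReal_inv, Complex.re_ofReal_mul]

/-- ★★ **`f_∞` UNDER A CHANGE OF UNITS**: `f_∞(sc, sm²) = ln s + f_∞(c, m²)` (`s > 0`, `c ≥ 0`, `m² > 0`; uniqueness of the thermodynamic limit along cubes).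
[cite: King1986, (2.20) p.654, (3.89) p.668, (4.4) p.670] -/
theorem kingFreeEnergyInf_scale {s c m2 : ℝ} (hs : 0 < s) (hc : 0 ≤ c) (hm : 0 < m2) :
    kingFreeEnergyInf (s * c) (s * m2) d = Real.log s + kingFreeEnergyInf c m2 d := by
  have hpos : ∀ (k : ℕ) (ν : Fin (d + 1)), 0 < (fun _ : Fin (d + 1) => k + 1) ν := fun k ν => Nat.succ_pos k
  have hlim : ∀ ν : Fin (d + 1), Tendsto (fun k : ℕ => (((fun _ : Fin (d + 1) => k + 1) ν : ℕ) : ℝ)) atTop atTop := fun ν =>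
    tendsto_natCast_atTop_atTop.comp (tendsto_add_atTop_nat 1)
  have h1 := tendsto_log_det_lapF_div_card (mul_nonneg hs.le hc) (mul_pos hs hm) (fun k _ => k + 1) hpos hlim (d := d)
  have h2 := (tendsto_log_det_lapF_div_card hc hm (fun k _ => k + 1) hpos hlim (d := d)).const_add (Real.log s)
  refine tendsto_nhds_unique h1 (h2.congr fun k => ?_)
  exact (log_det_lapF_div_card_scale (fun _ : Fin (d + 1) => k + 1) hs hc hm).symm

/-- ★ **REDUCTION TO UNIT MASS IN INFINITE VOLUME**: `f_∞(c, m²) = ln m² + f_∞(c∕m², 1)` and `K_∞(z; c, m²) = m⁻²·K_∞(z; c∕m², 1)`. [cite: King1986, (2.20) p.654, (3.89) p.668] -/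
theorem kingFreeEnergyInf_eq_log_mass_add {c m2 : ℝ} (hc : 0 ≤ c) (hm : 0 < m2) (z : Fin (d + 1) → ℤ) :
    kingFreeEnergyInf c m2 d = Real.log m2 + kingFreeEnergyInf (c / m2) 1 d ∧ freeKer c m2 z = m2⁻¹ * freeKer (c / m2) 1 z := by
  have e1 : m2 * (c / m2) = c := mul_div_cancel₀ c hm.ne'
  have e2 : m2 * (1 : ℝ) = m2 := mul_one m2
  have h1 := kingFreeEnergyInf_scale (d := d) hm (div_nonneg hc hm.le) one_pos
  have h2 := freeKer_scale m2 (c / m2) 1 z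
  rw [e1, e2] at h1 h2
  exact ⟨h1, h2⟩

end Infinite

end Summit.QuantumFields.YangMills.BalabanUVNodes.N15KingModelRung.TorusSpectral

end
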